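import Summits.QuantumFields.BalabanUV.Beta.D1BFx.PointColumnSplit

/-!
# `BalabanUV.Beta.D1BFx.PointColumnDual` — road «BF-x» for binder row D1, sub-leaf **L2-gh** (part 2a of 3):
# DUAL REGULARITY for the B4-Sect.5 whole-lattice kernel on `ℤ^d`: the point column read against a far `ℓ²` test function GAINS `η^{d/2}`
# over Combes–Thomas — `|Σ_{z∈S} g(z)·G′(z,q)| ≤ cDual(d,a)·e^{−δ_u R_b}·‖g‖₂/√((n+1)^d)` when the blocks of `S` are `≥ R_b + 2` from `blk q`

HONEST FRAMING (cell contract, verbatim): «discharging `BetaPertH` makes Bałaban's UV stability UNCONDITIONAL — a real constructive-QFT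
result; it is NOT the continuum limit and NOT the Clay problem.»  HONEST DEPENDENCY (verbatim): «continuum YM on T⁴ ⇐ BetaPertH ∧ nine
spine estimates (0/9 proved); BetaPertH ⇐ (D1) ∧ (D4) ∧ CAP+tail; G-an2-4 gates asym, D1 and NE2/3/4.»  THIS MODULE DISCHARGES NOTHING of
that: elementary elliptic regularity on `ℤ^d` (kernel-checked, [folklore]) for ONE leg species (T2's ghost leg) of ONE road to ONE conjunct (D1).
0 wall binders instantiated; NOT A2′/A1.ii, NOT D1, NOT BetaPertH, NOT continuum, NOT Clay.
ABSOLUTE RULE (cell, verbatim): «No internally-minted statement may enter as a cited fact. Every hypothesis is either kernel-proved in this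
package or a verbatim quotation of a PUBLISHED theorem with page reference.»  Nothing printed is asserted or cited; every theorem is proved
outright from pv23-g7's `B5Hk103ScalarZd` (`Gk`, `tsum_Gk_mul_AX`, `exp_rescale_le`), pv23's `B6QGQDecay237.gPrime_setDecay` (the `ℓ²`
Combes–Thomas set-to-set bound) and `dist_blk_ge`, `B6QGQLower276.AX_symm`, pv23-g4's `PoissonInterior` (through A3.a-P part 2:
`BlockColumnSupNorm.cI`/`interior_estimate_cI`), my `BlockColumnPoisson` (block geometry) and `PointColumnSplit.tsum_AX_mul_eq`; one constant with
a body (`cDual`), no `def … : Prop`.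

WHY (the far-field rows d0/d1 of `SquareTable.oneLoopDrift_of_scalarBounds_avg` for the ghost leg, A2′ `GhostRelegging`'s hypotheses; part 2b
`D1BFx/PointColumnDecay` consumes this file).  The far field of a point column `G′(·,q)` WITH THE MESH PREFACTOR `η^d` is invisible to an
operator-norm (Combes–Thomas) bound, which reads the point source `δ_q` in `ℓ²` where it has norm `1` at every mesh (`abs_Gk_le`: constant `O(1)`).
THE REPAIR ([folklore]): regularity AT THE SOURCE.  For `g` supported on a finite set `S` far from `q`, `W(y) := Σ_{z∈S} g(z)G′(z,y)` satisfies
`A W = 0` off `S` (`tsum_AX_mul_rowComb`; `G′A = 1` entrywise + symmetry of `A`), so `ΔW = a(n+1)^{−(d+2)}·(block sum of W)` there (`lap_rowComb`),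
and the block `ℓ¹` masses of `W` near `q` are `≤ (2/min(2,a))√((n+1)^d)e^{−δ_u R}‖g‖₂` (`sum_abs_rowComb_le`, Combes–Thomas against the sign pattern);
the interior estimate AT `q` (cube of radius `3⌊(n+1)/8⌋`, as in `BlockColumnSupNorm.gq_legs`) then gives **`abs_sum_mul_Gk_le_dual`** — a GAIN of
`1/√((n+1)^d) = η^{d/2}` over Combes–Thomas.  By duality this bounds the `ℓ¹` mass of the point column on far cubes, which part 2b feeds into the
interior estimate at the field point.
HONEST SCOPE: scalar `U = 1`, whole lattice, `d ≥ 3`; constant existential in `d` (`cI`); rate `δ_u` per block, not optimised.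
-/

namespace Summit.QuantumFields.BalabanUV.Beta.D1BFx.PointColumnDual

open Finset Real
open Literature.MathematicalPhysics.QuantumFieldTheory.Balaban1983to89
open Literature.Probability.LatticeModels (latticeLaplacianZd)
open B4Sect5Exhaustion (limInv)
open B6QGQLower276 (X e blk B mem_B B_disjoint U mem_U sum_U sum_B_const side side_facts lapKer sameBlk AX AX_symm Aker)
open B6QGQDecay237 (cU deltaU cU_pos deltaU_pos deltaU_le_one gPrime_setDecay dist_blk_ge)
open B5Hk103ScalarZd (Gk gq abs_Gk_le sum_AX_mul_Gk tsum_AX_mul tsum_Gk_mul_AX nbhd exp_rescale_le)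
open Beta.PoissonInterior (cube mem_cube supNorm nrm)
open BlockColumnPoisson (dist_blk_le_one dist_blk_le_one_of_mem_cube dist_le_one_of_mem_cube_one cube_subset_U card_cube)
open BlockColumnSupNorm (cI cI_nonneg interior_estimate_cI cG cG_pos abs_gq_le_sup)
open PointColumnSplit (tsum_AX_mul_eq)

noncomputable section

variable {d : ℕ}

/-! ## §1 Row combinations supported far away: Combes–Thomas masses, harmonicity off the support, dual regularity -/

/-- [folklore] **Block `ℓ¹` mass of a row combination by the set-to-set Combes–Thomas bound**: for `W(r) = Σ_{z∈S} g(z)G′(z,r)` and a block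
`B(y″)` at site distance `≥ R` from `S`, `Σ_{r∈B(y″)}|W(r)| ≤ (2/min(2,a))·e^{−δ_u R/(n+1)}·‖g‖₂·√((n+1)^d)` (pv23's `gPrime_setDecay` against the sign
pattern). -/
theorem sum_abs_rowComb_le (n : ℕ) {a : ℝ} (ha : 0 < a) (S : Finset (X d)) (g : X d → ℝ) (y'' : X d) (R : ℝ)
    (hR : ∀ z ∈ S, ∀ r ∈ B n y'', R ≤ dist z r) :
    ∑ r ∈ B n y'', |∑ z ∈ S, g z * Gk n a z r|
      ≤ 2 / min 2 a * Real.exp (-(deltaU d a * (R / ((n : ℝ) + 1)))) * Real.sqrt (∑ z ∈ S, g z ^ 2)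
        * Real.sqrt (((n : ℝ) + 1) ^ d) := by
  classical
  set W : X d → ℝ := fun r => ∑ z ∈ S, g z * Gk n a z r with hW
  set h : X d → ℝ := fun r => if 0 ≤ W r then 1 else -1 with hh
  have hct := gPrime_setDecay n ha Set.univ S (B n y'') (Set.subset_univ _) (Set.subset_univ _) R hR g h
  have hL : ∑ z ∈ S, ∑ r ∈ B n y'', g z * limInv Set.univ (Aker n a) (z, 0) (r, 0) * h r = ∑ r ∈ B n y'', |W r| := by
    rw [Finset.sum_comm]
    refine Finset.sum_congr rfl fun r _ => ?_
    have e1 : ∑ z ∈ S, g z * limInv Set.univ (Aker n a) (z, 0) (r, 0) * h r = h r * W r := by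
      rw [hW]; simp only [Finset.mul_sum]
      refine Finset.sum_congr rfl fun z _ => ?_
      rw [Gk]; ring
    rw [e1, hh]; simp only
    split_ifs with hr
    · rw [one_mul, abs_of_nonneg hr]
    · rw [abs_of_neg (not_le.mp hr)]; ring
  have hh2 : ∑ r ∈ B n y'', h r ^ 2 = ((n : ℝ) + 1) ^ d := by
    have : ∀ r ∈ B n y'', h r ^ 2 = 1 := fun r _ => by simp only [hh]; split_ifs <;> norm_num
    rw [Finset.sum_congr rfl this, sum_B_const, mul_one]
  rw [hL, hh2] at hct
  have hnn : 0 ≤ ∑ r ∈ B n y'', |W r| := Finset.sum_nonneg fun r _ => abs_nonneg (W r)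
  rw [abs_of_nonneg hnn] at hct
  exact hct

/-- [folklore] **`A W = 0` off the support**: `Σ'_s A(y,s)·W(s) = 0` for `y ∉ S` (`G′A = 1` entrywise, `tsum_Gk_mul_AX`, and the symmetry of `A`). -/
theorem tsum_AX_mul_rowComb (n : ℕ) {a : ℝ} (ha : 0 < a) (S : Finset (X d)) (g : X d → ℝ) {y : X d} (hy : y ∉ S) :
    ∑' s : X d, AX n a y s * ∑ z ∈ S, g z * Gk n a z s = 0 := by
  classical
  have hsum : ∀ z ∈ S, Summable fun s : X d => AX n a y s * (g z * Gk n a z s) := by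
    intro z _
    refine summable_of_ne_finset_zero (s := nbhd n y) fun s hs => ?_
    rw [B5Hk103ScalarZd.AX_eq_zero_of_not_mem a hs, zero_mul]
  calc ∑' s : X d, AX n a y s * ∑ z ∈ S, g z * Gk n a z s
      = ∑' s : X d, ∑ z ∈ S, AX n a y s * (g z * Gk n a z s) := tsum_congr fun s => by rw [Finset.mul_sum]
    _ = ∑ z ∈ S, ∑' s : X d, AX n a y s * (g z * Gk n a z s) := Summable.tsum_finsetSum hsum
    _ = ∑ z ∈ S, g z * (if z = y then 1 else 0) := by
        refine Finset.sum_congr rfl fun z _ => ?_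
        rw [← tsum_Gk_mul_AX n ha z y, ← tsum_mul_left]
        refine tsum_congr fun s => ?_
        rw [AX_symm n a y s]; ring
    _ = 0 := Finset.sum_eq_zero fun z hz => by
        rw [if_neg, mul_zero]
        rintro rfl
        exact hy hz

/-- [folklore] **The Laplacian of a row combination off its support is the block term**: `ΔW(y) = a(n+1)^{−(d+2)}·Σ_{s∈B(blk y)} W(s)` for `y ∉ S`. -/
theorem lap_rowComb (n : ℕ) {a : ℝ} (ha : 0 < a) (S : Finset (X d)) (g : X d → ℝ) {y : X d} (hy : y ∉ S) :
    latticeLaplacianZd (fun s => ∑ z ∈ S, g z * Gk n a z s) y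
      = a / ((n : ℝ) + 1) ^ (d + 2) * ∑ s ∈ B n (blk n y), ∑ z ∈ S, g z * Gk n a z s := by
  have h := tsum_AX_mul_rowComb n ha S g hy
  rw [tsum_AX_mul_eq] at h
  have hs : (0 : ℝ) < ((n : ℝ) + 1) ^ 2 := by positivity
  rw [pow_add, eq_comm, ← sub_eq_zero]
  have e1 : a / (((n : ℝ) + 1) ^ d * ((n : ℝ) + 1) ^ 2) * ∑ s ∈ B n (blk n y), ∑ z ∈ S, g z * Gk n a z s
      - latticeLaplacianZd (fun s => ∑ z ∈ S, g z * Gk n a z s) y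
      = (-(((n : ℝ) + 1) ^ 2 * latticeLaplacianZd (fun s => ∑ z ∈ S, g z * Gk n a z s) y)
          + a / ((n : ℝ) + 1) ^ d * ∑ s ∈ B n (blk n y), ∑ z ∈ S, g z * Gk n a z s) / ((n : ℝ) + 1) ^ 2 := by
    field_simp
    ring
  rw [e1, h, zero_div]

/-- [our object] **The dual-regularity constant** `cDual(d,a) = (cI d·(a + 48^d) + 7^d)·(2/min(2,a))·e`. -/
def cDual (d : ℕ) (a : ℝ) : ℝ := (cI d * (a + 48 ^ d) + 7 ^ d) * (2 / min 2 a) * Real.exp 1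

/-- [folklore] `cDual d a > 0` for `a > 0`. -/
theorem cDual_pos (d : ℕ) {a : ℝ} (ha : 0 < a) : 0 < cDual d a := by
  unfold cDual; have := cI_nonneg d; have : 0 < min 2 a := lt_min two_pos ha; positivity

/-- [folklore] **DUAL REGULARITY — the point column read against a far test function gains `η^{d/2}` over Combes–Thomas**:
if every `z ∈ S` has `dist (blk z) (blk q) ≥ R_b + 2` (`R_b ≥ 0`), then
`|Σ_{z∈S} g(z)·G′(z,q)| ≤ cDual(d,a)·e^{−δ_u R_b}·‖g‖₂ / √((n+1)^d)`. -/
theorem abs_sum_mul_Gk_le_dual (hd : 3 ≤ d) (n : ℕ) {a : ℝ} (ha : 0 < a) (S : Finset (X d)) (g : X d → ℝ) (q : X d)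
    {Rb : ℝ} (hRb : 0 ≤ Rb) (hfar : ∀ z ∈ S, Rb + 2 ≤ dist (blk n z) (blk n q)) :
    |∑ z ∈ S, g z * Gk n a z q|
      ≤ cDual d a * Real.exp (-(deltaU d a * Rb)) * Real.sqrt (∑ z ∈ S, g z ^ 2) / Real.sqrt (((n : ℝ) + 1) ^ d) := by
  classical
  set δ := deltaU d a with hδ
  have hδ0 : 0 < δ := deltaU_pos d ha
  have hδ1 : δ ≤ 1 := deltaU_le_one d a
  have hs0 : (0 : ℝ) < (n : ℝ) + 1 := by positivity
  set Sn := Real.sqrt (((n : ℝ) + 1) ^ d) with hSn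
  have hSn0 : 0 < Sn := Real.sqrt_pos.2 (by positivity)
  have hSnsq : Sn * Sn = ((n : ℝ) + 1) ^ d := Real.mul_self_sqrt (by positivity)
  set Ng := Real.sqrt (∑ z ∈ S, g z ^ 2) with hNg
  have hNg0 : 0 ≤ Ng := Real.sqrt_nonneg _
  set σ : ℝ := 2 / min 2 a with hσ
  have hσ0 : 0 < σ := div_pos two_pos (lt_min two_pos ha)
  set E := Real.exp (-(δ * Rb)) with hE
  have hE0 : 0 < E := Real.exp_pos _
  have he1 : (1 : ℝ) ≤ Real.exp 1 := Real.one_le_exp zero_le_one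
  have hCI := cI_nonneg d
  set W : X d → ℝ := fun s => ∑ z ∈ S, g z * Gk n a z s with hW
  -- `q` and the blocks adjacent to `blk q` are at block distance `≥ R_b` from `S`; no point of them lies in `S`
  have hnotS : ∀ y : X d, dist (blk n y) (blk n q) ≤ 1 → y ∉ S := by
    intro y hy hyS
    have := hfar y hyS
    linarith
  -- Combes–Thomas masses on the blocks adjacent to `blk q`
  have hmass : ∀ y'' : X d, dist y'' (blk n q) ≤ 1 →
      ∑ r ∈ B n y'', |W r| ≤ σ * (Real.exp δ * E) * Ng * Sn := by
    intro y'' hy''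
    have hR : ∀ z ∈ S, ∀ r ∈ B n y'', ((n : ℝ) + 1) * Rb - n ≤ dist z r := by
      intro z hz r hr
      have h1 := dist_blk_ge (mem_B.2 rfl : z ∈ B n (blk n z)) hr
      have h2 : Rb ≤ dist (blk n z) y'' := by
        have := dist_triangle (blk n z) y'' (blk n q)
        linarith [hfar z hz]
      nlinarith
    refine (sum_abs_rowComb_le n ha S g y'' _ hR).trans ?_
    rw [← hσ, ← hδ, ← hNg, ← hSn]
    have hexp := exp_rescale_le n hδ0.le Rb
    have : Real.exp (-(δ * ((((n : ℝ) + 1) * Rb - n) / ((n : ℝ) + 1)))) ≤ Real.exp δ * E := hexp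
    gcongr
  -- the pointwise Combes–Thomas bound at `q` (crude case)
  have hpt : |W q| ≤ σ * (Real.exp δ * E) * Ng := by
    have hR : ∀ z ∈ S, ∀ r ∈ ({q} : Finset (X d)), ((n : ℝ) + 1) * Rb - n ≤ dist z r := by
      intro z hz r hr
      rw [Finset.mem_singleton] at hr; subst hr
      have h1 := dist_blk_ge (mem_B.2 rfl : z ∈ B n (blk n z)) (mem_B.2 rfl : r ∈ B n (blk n r))
      have h2 := hfar z hz
      nlinarith
    have hct := gPrime_setDecay n ha Set.univ S {q} (Set.subset_univ _) (Set.subset_univ _) _ hR g (fun _ => 1)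
    simp only [Finset.sum_singleton, mul_one, one_pow, Real.sqrt_one] at hct
    have hL : ∑ z ∈ S, g z * limInv Set.univ (Aker n a) (z, 0) (q, 0) = W q := by rw [hW]; rfl
    rw [hL] at hct
    refine hct.trans ?_
    rw [← hσ, ← hδ, ← hNg]
    have hexp := exp_rescale_le n hδ0.le Rb
    gcongr
  by_cases hn7 : n + 1 ≤ 7
  · -- bounded mesh: `1 ≤ 7^d / √((n+1)^d)` absorbs the missing factor
    have hn7' : (n : ℝ) + 1 ≤ 7 := by exact_mod_cast hn7
    have hSn7 : Sn ≤ 7 ^ d := by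
      rw [hSn, Real.sqrt_le_left (by positivity)]
      have h7 : (1 : ℝ) ≤ 7 ^ d := one_le_pow₀ (by norm_num)
      calc ((n : ℝ) + 1) ^ d ≤ 7 ^ d := pow_le_pow_left₀ hs0.le hn7' d
        _ ≤ (7 ^ d) ^ 2 := by nlinarith [mul_nonneg (sub_nonneg.2 h7) (zero_le_one.trans h7)]
    rw [le_div_iff₀ hSn0]
    calc |W q| * Sn ≤ (σ * (Real.exp δ * E) * Ng) * 7 ^ d := mul_le_mul hpt hSn7 hSn0.le (by positivity)
      _ ≤ (σ * (Real.exp 1 * E) * Ng) * 7 ^ d := by gcongr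
      _ = (7 ^ d * σ * Real.exp 1) * E * Ng := by ring
      _ ≤ cDual d a * E * Ng := by
          apply mul_le_mul_of_nonneg_right _ hNg0
          apply mul_le_mul_of_nonneg_right _ hE0.le
          unfold cDual; rw [← hσ]
          have : 0 ≤ cI d * (a + 48 ^ d) * σ * Real.exp 1 := by positivity
          nlinarith
  · -- `n + 1 ≥ 8`: the interior estimate at `q` on the cube of radius `3m`, `m = ⌊(n+1)/8⌋`
    rw [not_le] at hn7
    set m : ℕ := (n + 1) / 8 with hm
    have hm1 : 1 ≤ m := by omega
    have h16m : n + 1 ≤ 16 * m := by omega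
    have hmR : (m : ℝ) ≤ (n : ℝ) + 1 := by exact_mod_cast (show m ≤ n + 1 by omega)
    have h16R : (n : ℝ) + 1 ≤ 16 * m := by exact_mod_cast h16m
    have hm0 : (0 : ℝ) < m := by exact_mod_cast hm1
    have h3m : 3 * m ≤ n + 1 := by omega
    -- (hA) Laplacian bound on the cube
    set A : ℝ := a / ((n : ℝ) + 1) ^ (d + 2) * (σ * (Real.exp δ * E) * Ng * Sn) with hA
    have hAbd : ∀ z ∈ cube q (3 * m), |latticeLaplacianZd W z| ≤ A := by
      intro z hz
      have hzq : dist (blk n z) (blk n q) ≤ 1 := dist_blk_le_one_of_mem_cube h3m hz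
      rw [hW, lap_rowComb n ha S g (hnotS z hzq), abs_mul, abs_of_pos (by positivity), hA]
      exact mul_le_mul_of_nonneg_left ((Finset.abs_sum_le_sum_abs _ _).trans (hmass (blk n z) hzq)) (by positivity)
    -- (hB) `ℓ¹` bound on the cube through the `3^d` adjacent blocks
    set Bc : ℝ := 3 ^ d * (σ * (Real.exp δ * E) * Ng * Sn) with hBc
    have hBbd : (∑ z ∈ cube q (3 * m), |W z|) ≤ Bc := by
      calc (∑ z ∈ cube q (3 * m), |W z|) ≤ ∑ z ∈ U n (cube (blk n q) 1), |W z| :=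
            Finset.sum_le_sum_of_subset_of_nonneg (cube_subset_U h3m q) fun _ _ _ => abs_nonneg _
        _ = ∑ y'' ∈ cube (blk n q) 1, ∑ z ∈ B n y'', |W z| := sum_U _ _
        _ ≤ ∑ y'' ∈ cube (blk n q) 1, σ * (Real.exp δ * E) * Ng * Sn :=
            Finset.sum_le_sum fun y'' hy'' => hmass y'' (by rw [dist_comm]; exact dist_le_one_of_mem_cube_one hy'')
        _ = Bc := by rw [Finset.sum_const, card_cube, nsmul_eq_mul, hBc]; push_cast; ring
    obtain ⟨hval, -⟩ := interior_estimate_cI hd hm1 W q A Bc hAbd hBbd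
    have h16d : ((n : ℝ) + 1) ^ d ≤ 16 ^ d * (m : ℝ) ^ d := by
      rw [← mul_pow]; exact pow_le_pow_left₀ hs0.le h16R d
    have hmd : (0 : ℝ) < (m : ℝ) ^ d := by positivity
    -- arithmetic: `m²A ≤ a σ e E Ng / Sn`, `Bc/m^d ≤ 48^d σ e E Ng / Sn`
    have hP : 0 ≤ σ * (Real.exp δ * E) * Ng * Sn := by positivity
    have h1 : (m : ℝ) ^ 2 * A ≤ a * (σ * (Real.exp δ * E) * Ng) / Sn := by
      rw [hA, le_div_iff₀ hSn0]
      have : (m : ℝ) ^ 2 ≤ ((n : ℝ) + 1) ^ 2 := pow_le_pow_left₀ hm0.le hmR 2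
      calc (m : ℝ) ^ 2 * (a / ((n : ℝ) + 1) ^ (d + 2) * (σ * (Real.exp δ * E) * Ng * Sn)) * Sn
          = (m : ℝ) ^ 2 * (a * (σ * (Real.exp δ * E) * Ng) * (Sn * Sn)) / ((n : ℝ) + 1) ^ (d + 2) := by ring
        _ ≤ ((n : ℝ) + 1) ^ 2 * (a * (σ * (Real.exp δ * E) * Ng) * (Sn * Sn)) / ((n : ℝ) + 1) ^ (d + 2) := by
            apply div_le_div_of_nonneg_right _ (by positivity)
            exact mul_le_mul_of_nonneg_right this (by positivity)
        _ = a * (σ * (Real.exp δ * E) * Ng) := by rw [hSnsq, pow_add]; field_simp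
    have h2 : Bc / (m : ℝ) ^ d ≤ 48 ^ d * (σ * (Real.exp δ * E) * Ng) / Sn := by
      rw [hBc, div_le_div_iff₀ hmd hSn0]
      calc 3 ^ d * (σ * (Real.exp δ * E) * Ng * Sn) * Sn = 3 ^ d * (σ * (Real.exp δ * E) * Ng) * ((n : ℝ) + 1) ^ d := by
            rw [← hSnsq]; ring
        _ ≤ 3 ^ d * (σ * (Real.exp δ * E) * Ng) * (16 ^ d * (m : ℝ) ^ d) := mul_le_mul_of_nonneg_left h16d (by positivity)
        _ = 48 ^ d * (σ * (Real.exp δ * E) * Ng) * (m : ℝ) ^ d := by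
            rw [show (48 : ℝ) ^ d = 3 ^ d * 16 ^ d by rw [← mul_pow]; norm_num]; ring
    rw [le_div_iff₀ hSn0]
    calc |W q| * Sn ≤ cI d * ((m : ℝ) ^ 2 * A + Bc / (m : ℝ) ^ d) * Sn := mul_le_mul_of_nonneg_right hval hSn0.le
      _ ≤ cI d * (a * (σ * (Real.exp δ * E) * Ng) / Sn + 48 ^ d * (σ * (Real.exp δ * E) * Ng) / Sn) * Sn :=
          mul_le_mul_of_nonneg_right (mul_le_mul_of_nonneg_left (add_le_add h1 h2) hCI) hSn0.le
      _ = cI d * (a + 48 ^ d) * σ * Real.exp δ * E * Ng := by field_simp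
      _ ≤ cI d * (a + 48 ^ d) * σ * Real.exp 1 * E * Ng := by gcongr
      _ ≤ cDual d a * E * Ng := by
          apply mul_le_mul_of_nonneg_right _ hNg0
          apply mul_le_mul_of_nonneg_right _ hE0.le
          unfold cDual; rw [← hσ]
          have : 0 ≤ (7 : ℝ) ^ d * σ * Real.exp 1 := by positivity
          nlinarith

end

end Summit.QuantumFields.BalabanUV.Beta.D1BFx.PointColumnDual
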